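import Summits.QuantumFields.YangMills.Theorems.BalabanUVNodesPortS1ChartLawStar

/-!
# NODE O port PT-A — FE-1's chart law (T1), brick (b2) of ★★★ №691 (2)(b): THE BUNDLE-EXPLICIT POINTWISE FORM OF ★ AND THE CONTINUITY TRANSFER — for EVERY blind sharp bundle of the
# central α-window and EVERY coarse field `W` with `Ū(ctr W) = W`, loops `≤ αD`: N11's FULL FIBRE INTEGRAL `∫ 𝟙·Π_c jd_c·ρ∘Ψ dU` at `W` EQUALS the solved-form (2.10) integral `g(W)`
# POINTWISE (no a.e.); hence `ContinuousOn g U₀ ↔ ContinuousOn (fibre integral) U₀` on `U₀ ⊆ G`, and (★) holds pointwise on `U₀` as soon as the FIBRE integral of ANY blind sharp bundle is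
# continuous there — the `hgc` of dag-n09's (F1)∕(C) road (✓`…N09FibreIntegralContinuousOfChartRegularity`), whose currency this is ([I] (2.10) p.267, p.259 «analytic in U_{k+1}»)

Cell `ym-nodeO-ideate`, porter seat PT-A-1 (gen 14); `--kind proof --supports stmt-QuantumFields-27930 --as helper`; count-neutral.  [I] = [Balaban1987RG1]; [16] = [Balaban1985UV3].
Docket ★★★ director-ym №691 (2)(b) (sizing note nodeO STATUS 2026-09-01T00:29Z: (b) = (b1) jointly-continuous blind sharp bundle + (b2) this transfer).  Over ✓`…ChartLawPointwise` (p838412: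
`privateIntegrand_chart_eq_indicator_solved`), ✓`…ChartLawStar` (p838454), ✓`…ChartBlind` (`integral_privateChart_eq_integral_offCentral`),
✓`…ChartJacobianFull` (`integral_pi_haar_eq_chart`), ✓`…ChartRem`, dag-n11 ✓`measurable_privateChart`∕`measurable_privateJacobian`, Node00 ✓`TcanOfRecord_eqOn_of_continuousOn`∕`TcanOfRecord_ae_eq`.

WHAT IS PROVED (0 `def`, 0 `sorry`).
§1 ★★★ `integral_privateChart_eq_integral_solvedChart` — for EVERY blind sharp bundle `(T, ϑ, jd, jac′)` (N11's clause shapes), every `W` with `Ū(ctr W) = W`, loops of `ctr W` `≤ αD`, under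
  (B1)∕`hCr`∕(S) with `ρ` measurable: `∫ U, 𝟙[∀c, W c ∈ T_c U]·Π_c jd_c(U, W c)·ρ(extend β (ϑ_c(U, W c))_c U) dU = σ₀^{#{b∉range β}} · ∫_{remWindow r} fluctSigma(fluctVec Y)·(Π|det_c|)⁻¹·ρ(pert (ctr W) Y) dy` —
  POINTWISE (dummy reduction ✓`integral_privateChart_eq_integral_offCentral` → Pauli chart → DEF-1's carrier → §2 of p838412 → the window).
§2 ★★ `continuousOn_solvedChart_iff_fibreIntegral` — on any `U₀ ⊆ G`: `ContinuousOn g U₀ ↔ ContinuousOn (W ↦ the fibre integral) U₀`.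
§3 ★★★ `TcanOfRecord_eq_integral_solvedChart_of_fibreIntegral_continuousOn` — (★) POINTWISE on an open `U₀ ⊆ G` from the continuity on `U₀` of the fibre integral of ANY blind sharp
  bundle (N11's numerics (N), `ρ` integrable, the `D̃`-ball clause `hCr` as in ✓p838454 — dischargeable by ✓p838685's `hCr_of_rowBound`).

HONEST FRAMING.  Identities and a `continuousOn_congr`; the continuity itself is NOT proved here — it is dag-n09's (F1) tower (✓`continuousOn_fibreIntegral_betaInput_chi29_of_chartRegularity`,
modulo ITS displayed rows) once a blind sharp bundle with JOINTLY continuous `jac′` ((b1), not yet filed) feeds it; (B-T2) NOT here; no Bałaban RG estimate asserted, ported or discharged;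
`FEChartLawReg`∕`FEPolymerActivitiesReg`∕`P0HolExtAtRecordGL`∕`ClassP2Reg`∕`RegSelSmoothOnClass`∕`RegClassNestsUc` inhabited NOWHERE; ⟨27930⟩ OPEN 2∕7 · no claim; NODE O 0∕1; COUNT 8∕28 ·
K 1∕4 · legs 0∕6 UNMOVED; finite `𝕋⁴_{L^K}` at fixed ε — NOT continuum ∕ OS; **the Yang–Mills mass gap (Clay) is NOT proved by any of this.**  No `sorry`, no `def`, no `instance`; standard axioms only.
-/

noncomputable section

open MeasureTheory MeasureTheory.Measure Set Metric Function Filter Topology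
open scoped ENNReal NNReal BigOperators Matrix.Norms.L2Operator

namespace Summit.QuantumFields.YangMills.Theorems.BalabanUVNodesPortS1

open Literature.MathematicalPhysics.QuantumFieldTheory (haarProbability)
open Literature.MathematicalPhysics.QuantumFieldTheory.Balaban1983to89
open Literature.MathematicalPhysics.QuantumFieldTheory.Balaban1983to89.Node00
open Literature.MathematicalPhysics.QuantumFieldTheory.Balaban1983to89.T4Continuum (T4Family)
open Literature.MathematicalPhysics.QuantumFieldTheory.Balaban1983to89.B10Eq22Rescaling (sigmaSU2 sigmaSU2_zero)
open Literature.MathematicalPhysics.QuantumFieldTheory.Balaban1983to89.B10Eq18SigmaSU2Haar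
open Literature.MathematicalPhysics.QuantumFieldTheory.Balaban1983to89.BlockAveraging (avgFun loopHol Small Idx)
open Literature.MathematicalPhysics.QuantumFieldTheory.Balaban1983to89.BlockAveragingHaarAC (centralBond pre post centralBond_injective)
open Literature.MathematicalPhysics.QuantumFieldTheory.Balaban1983to89.BlockAveragingEMLHaarAC (fibreFamily offCard)
open Literature.MathematicalPhysics.QuantumFieldTheory.Balaban1983to89.ExpMeanLog (expMeanLogSU deltaSU)
open Summit.QuantumFields.YangMills.Theorems.K0RecordFormatNames
open Summit.QuantumFields.YangMills.Theorems.BalabanUVNodesN11TransportOfRecordInPrivateCoordinateChart (succ_le_m_add_K measurable_privateChart measurable_privateJacobian)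
open _root_.Matrix

variable (F : T4Family)

/-! ## §1  The fibre integral of any blind sharp bundle equals the solved-form integral, pointwise -/

section Pointwise

variable {F}

/-- ★★★ **N11's FULL FIBRE INTEGRAL AT `W` EQUALS THE SOLVED-FORM (2.10) INTEGRAL — POINTWISE, FOR EVERY BLIND SHARP BUNDLE.**  (`W` with `Ū(ctr W) = W` and loops `≤ αD`; (B1) budget, the
`D̃`-ball clause `hCr` at `W`, the support clause (S), `ρ` measurable; the bundle's clauses in N11's shapes.)  Dummy reduction (✓`integral_privateChart_eq_integral_offCentral`), the off-central
Pauli chart at centre `ctr W` (✓`integral_pi_haar_eq_chart`), DEF-1's carrier (✓`setIntegral_pi_ball_eq_setIntegral_remWindow`), then ✓`privateIntegrand_chart_eq_indicator_solved` pointwise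
in `y` and the window. [cite: Balaban1987RG1, (2.10) p.267, p.268 L1–3, (2.4) p.266, (2.9) p.266] [cite: Balaban1985UV3, (18) p.260] -/
theorem integral_privateChart_eq_integral_solvedChart {K k : ℕ} (hk : k < K) {α αD r ρD : ℝ}
    (hαDL : 157 * αD < (((F.P K).L : ℝ) ^ ((F.P K).d - 1))⁻¹)
    (hbudget : αD + ((((F.P K).d + 2) * (F.P K).L : ℕ) : ℝ) * (Real.exp (3 * ((1 : ℝ) / (10 ^ 8 * (F.P K).d * (F.P K).L))) - 1) ≤ α)
    (hrR : r ≤ (1 : ℝ) / (10 ^ 8 * (F.P K).d * (F.P K).L))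
    (hρD : ρD = (min ((1 : ℝ) / (10 ^ 8 * (F.P K).d * (F.P K).L) / 3) (1 / (18 * (2 * 1 / (1 / (10 ^ 8 * (F.P K).d * (F.P K).L)) ^ 2) * ((6 / ((((F.P K).L : ℝ) ^ ((F.P K).d - 1))⁻¹ - 157 * αD)) + 1)))))
    {T : PBond (F.P K) (k + 1) → GaugeField (F.P K) k (SU 2) → Set (SU 2)}
    {ϑ : PBond (F.P K) (k + 1) → GaugeField (F.P K) k (SU 2) → SU 2 → SU 2}
    {jd jac' : PBond (F.P K) (k + 1) → GaugeField (F.P K) k (SU 2) → SU 2 → ℝ≥0}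
    (hTm : ∀ c, MeasurableSet {p : GaugeField (F.P K) k (SU 2) × SU 2 | p.2 ∈ T c p.1})
    (hθm : ∀ c, Measurable fun p : GaugeField (F.P K) k (SU 2) × SU 2 => ϑ c p.1 p.2)
    (hjm : ∀ c, Measurable fun p : GaugeField (F.P K) k (SU 2) × SU 2 => jd c p.1 p.2)
    (hjacm : ∀ c, Measurable fun p : GaugeField (F.P K) k (SU 2) × SU 2 => jac' c p.1 p.2)
    (hright : ∀ c U, ∀ v ∈ T c U, (avOfRecord F 2 K k).avg (update U (centralBond c) (ϑ c U v)) c = v)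
    (hTim : ∀ c U, T c U = (fun g => (avOfRecord F 2 K k).avg (update U (centralBond c) g) c) ''
      {g : SU 2 | ∀ i : Idx (F.P K), dist1 (fibreFamily U c (pre U c * g * post U c) i) ≤ α})
    (hleft : ∀ c U g, (∀ i : Idx (F.P K), dist1 (fibreFamily U c (pre U c * g * post U c) i) ≤ α) →
      ϑ c U ((avOfRecord F 2 K k).avg (update U (centralBond c) g) c) = g)
    (hQ : ∀ c U v, jd c U v = (jac' c U (ϑ c U v))⁻¹)
    (hjac0 : ∀ c U g, (∀ i : Idx (F.P K), dist1 (fibreFamily U c (pre U c * g * post U c) i) ≤ α) → jac' c U g ≠ 0)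
    (hfwd : ∀ c U, (HaarData.haar : Measure (SU 2)).restrict
        ((fun g => (avOfRecord F 2 K k).avg (update U (centralBond c) g) c) ''
          {g : SU 2 | ∀ i : Idx (F.P K), dist1 (fibreFamily U c (pre U c * g * post U c) i) ≤ α}) =
      (((HaarData.haar : Measure (SU 2)).restrict {g : SU 2 | ∀ i : Idx (F.P K), dist1 (fibreFamily U c (pre U c * g * post U c) i) ≤ α}).withDensity
          fun g => (jac' c U g : ℝ≥0∞)).map (fun g => (avOfRecord F 2 K k).avg (update U (centralBond c) g) c))
    (hjacc : ∀ c U, ContinuousOn (jac' c U) {g : SU 2 | ∀ i : Idx (F.P K), dist1 (fibreFamily U c (pre U c * g * post U c) i) ≤ α})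
    (hTbl : ∀ c U (g : PBond (F.P K) (k + 1) → SU 2), T c (extend centralBond g U) = T c U)
    (hθbl : ∀ c U (g : PBond (F.P K) (k + 1) → SU 2), ϑ c (extend centralBond g U) = ϑ c U)
    (hjbl : ∀ c U (g : PBond (F.P K) (k + 1) → SU 2), jd c (extend centralBond g U) = jd c U)
    (ctr : (PBond (F.P K) (k + 1) → SU 2) → GaugeField (F.P K) k (SU 2)) {W : PBond (F.P K) (k + 1) → SU 2}
    (hW : (avOfRecord F 2 K k).avg (ctr W) = W) (hWD : ∀ (c : PBond (F.P K) (k + 1)) (i : Idx (F.P K)), dist1 (loopHol (ctr W) c i) ≤ αD)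
    (hCr : ∀ y : NonB0Idx F k K → ℝ, (∀ (b : PBond (F.P K) k) (hb : b ∉ Set.range (recordB0 F k K)), √(∑ a : Fin 3, y ⟨(b, a), hb⟩ ^ 2) < r) →
      ‖(fun i => ((((1 : ℝ) • (recordCopFluct F k K (ctr W) *ᵥ y)) i : ℝ) : ℂ))‖ < ρD)
    {ρ : Density (F.P K) k (SU 2)} (hρm : Measurable ρ)
    (hS : ∀ U, ρ U ≠ 0 → (∀ (c : PBond (F.P K) (k + 1)) (i : Idx (F.P K)), dist1 (loopHol U c i) < α) ∧
      ∃ x : FluctIdx F k K → ℝ, (∀ b, ‖fluctVec F k K x b‖ < r) ∧ U = pert F k K (ctr ((avOfRecord F 2 K k).avg U)) x) :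
    ∫ U, ((({p : GaugeField (F.P K) (k + 1) (SU 2) × GaugeField (F.P K) k (SU 2) | ∀ c, p.1 c ∈ T c p.2}.indicator (fun p => ∏ c, jd c p.2 (p.1 c)) (W, U) : ℝ≥0) : ℝ) *
        ρ (extend centralBond (fun c => ϑ c U (W c)) U)) ∂(fieldMeasure (F.P K) k (SU 2)) =
      (sigmaSU2 0) ^ Fintype.card {b : PBond (F.P K) k // b ∉ Set.range (recordB0 F k K)} *
          ∫ y in {y : NonB0Idx F k K → ℝ | ∀ (b : PBond (F.P K) k) (hb : b ∉ Set.range (recordB0 F k K)), √(∑ a : Fin 3, y ⟨(b, a), hb⟩ ^ 2) < r},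
            fluctSigma (fluctVec F k K (recordReparamOf F k (fun Vk => recordDt F k K Vk ρD) (ctr W) 1 (recordCopFluct F k K (ctr W) *ᵥ y))) *
          ((∏ c : PBond (F.P K) (k + 1),
              |(fderiv ℝ (fun a : EuclideanSpace ℝ (Fin 3) =>
                  (WithLp.toLp 2 (su2Coord (recordQt F k K (ctr W) ((fluctVec F k K).symm (update (fluctVec F k K
                    (recordReparamOf F k (fun Vk => recordDt F k K Vk ρD) (ctr W) 1 (recordCopFluct F k K (ctr W) *ᵥ y))) (centralBond c) a)) c)) : EuclideanSpace ℝ (Fin 3)))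
                (fluctVec F k K (recordReparamOf F k (fun Vk => recordDt F k K Vk ρD) (ctr W) 1 (recordCopFluct F k K (ctr W) *ᵥ y)) (centralBond c))).det|)⁻¹ *
            ρ (pert F k K (ctr W) (recordReparamOf F k (fun Vk => recordDt F k K Vk ρD) (ctr W) 1 (recordCopFluct F k K (ctr W) *ᵥ y)))) := by
  have hd : (1 : ℝ) ≤ (F.P K).d := by exact_mod_cast (F.P K).hd
  have hL : (1 : ℝ) ≤ (F.P K).L := by exact_mod_cast (F.P K).hL.2.le
  have hRle : (1 : ℝ) / (10 ^ 8 * (F.P K).d * (F.P K).L) ≤ 1 / 10 ^ 8 := one_div_le_one_div_of_le (by positivity) (by nlinarith)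
  have hrπ : r < Real.pi := by linarith [hrR.trans hRle, Real.pi_gt_three]
  classical
  -- dummy reduction (pointwise in `W`, any dummy; we take `1`)
  rw [integral_privateChart_eq_integral_offCentral hk hTbl hθbl hjbl ρ W (fun _ => (1 : SU 2))]
  -- measurability of N11's integrand at `W` and of the dummy fill
  have hfm : Measurable fun U : GaugeField (F.P K) k (SU 2) =>
      (({p : GaugeField (F.P K) (k + 1) (SU 2) × GaugeField (F.P K) k (SU 2) | ∀ c, p.1 c ∈ T c p.2}.indicator
          (fun p => ∏ c, jd c p.2 (p.1 c)) (W, U) : ℝ≥0) : ℝ) * ρ (extend centralBond (fun c => ϑ c U (W c)) U) := by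
    have h1 : Measurable fun U : GaugeField (F.P K) k (SU 2) =>
        {p : GaugeField (F.P K) (k + 1) (SU 2) × GaugeField (F.P K) k (SU 2) | ∀ c, p.1 c ∈ T c p.2}.indicator (fun p => ∏ c, jd c p.2 (p.1 c)) (W, U) :=
      (measurable_privateJacobian T jd hTm hjm).comp (measurable_const.prodMk measurable_id)
    have h2 : Measurable fun U : GaugeField (F.P K) k (SU 2) => (extend centralBond (fun c => ϑ c U (W c)) U : GaugeField (F.P K) k (SU 2)) :=
      (measurable_privateChart ϑ hk hθm).comp (measurable_const.prodMk measurable_id)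
    exact (measurable_coe_nnreal_real.comp h1).mul (hρm.comp h2)
  have hfill : Measurable fun U' : {b : PBond (F.P K) k // b ∉ Set.range (recordB0 F k K)} → SU 2 =>
      (fun b => if h : b ∈ Set.range (centralBond : PBond (F.P K) (k + 1) → PBond (F.P K) k) then (fun _ : PBond (F.P K) k => (1 : SU 2)) b else U' ⟨b, h⟩ :
        GaugeField (F.P K) k (SU 2)) := by
    refine measurable_pi_lambda _ fun b => ?_
    by_cases h : b ∈ Set.range (centralBond : PBond (F.P K) (k + 1) → PBond (F.P K) k)
    · simp only [dif_pos h]; exact measurable_const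
    · simp only [dif_neg h]; exact measurable_pi_apply _
  -- the off-central Haar integral in the Pauli chart at centre `ctr W|off`
  have step1 := integral_pi_haar_eq_chart (fun b' : {b : PBond (F.P K) k // b ∉ Set.range (recordB0 F k K)} => ctr W b'.1)
    (fun U' : {b : PBond (F.P K) k // b ∉ Set.range (recordB0 F k K)} → Matrix.specialUnitaryGroup (Fin 2) ℂ =>
      (({p : GaugeField (F.P K) (k + 1) (SU 2) × GaugeField (F.P K) k (SU 2) | ∀ c, p.1 c ∈ T c p.2}.indicator
          (fun p => ∏ c, jd c p.2 (p.1 c))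
            (W, fun b => if h : b ∈ Set.range (centralBond : PBond (F.P K) (k + 1) → PBond (F.P K) k) then (fun _ : PBond (F.P K) k => (1 : SU 2)) b else U' ⟨b, h⟩) : ℝ≥0) : ℝ) *
        ρ (extend centralBond
          (fun c => ϑ c (fun b => if h : b ∈ Set.range (centralBond : PBond (F.P K) (k + 1) → PBond (F.P K) k) then (fun _ : PBond (F.P K) k => (1 : SU 2)) b else U' ⟨b, h⟩) (W c))
          (fun b => if h : b ∈ Set.range (centralBond : PBond (F.P K) (k + 1) → PBond (F.P K) k) then (fun _ : PBond (F.P K) k => (1 : SU 2)) b else U' ⟨b, h⟩)))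
    (hfm.comp hfill).aestronglyMeasurable
  refine step1.trans ?_
  rw [smul_eq_mul]
  congr 1
  rw [setIntegral_pi_ball_eq_setIntegral_remWindow F k K Real.pi]
  refine (setIntegral_congr_fun (measurableSet_remWindow F k K Real.pi) fun y hy =>
    privateIntegrand_chart_eq_indicator_solved hk hαDL hbudget hrR hρD hjacm hright hTim hleft hQ hjac0 hfwd hjacc hTbl hθbl hjbl ctr hW hWD hCr hS
      (fun _ => (1 : SU 2)) y hy).trans ?_
  rw [setIntegral_indicator (measurableSet_remWindow F k K r)]
  have hsub : {y : NonB0Idx F k K → ℝ | ∀ (b : PBond (F.P K) k) (hb : b ∉ Set.range (recordB0 F k K)), √(∑ a : Fin 3, y ⟨(b, a), hb⟩ ^ 2) < r} ⊆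
      {y : NonB0Idx F k K → ℝ | ∀ (b : PBond (F.P K) k) (hb : b ∉ Set.range (recordB0 F k K)), √(∑ a : Fin 3, y ⟨(b, a), hb⟩ ^ 2) < Real.pi} :=
    fun y hy b hb => (hy b hb).trans hrπ
  rw [inter_eq_right.2 hsub]

/-- ★★ **CONTINUITY TRANSFER**: on every `U₀` whose points satisfy `Ū(ctr W) = W` and loops of `ctr W` `≤ αD` (and on which `hCr` holds), the solved-form integral is continuous on `U₀` IFF
the fibre integral of the (any) blind sharp bundle is — the `hgc` of dag-n09's (F1)∕(C) road, in either currency. [cite: Balaban1987RG1, (2.10) p.267, p.259 («analytic functions of U_{k+1}»)] -/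
theorem continuousOn_solvedChart_iff_fibreIntegral {K k : ℕ} (hk : k < K) {α αD r ρD : ℝ}
    (hαDL : 157 * αD < (((F.P K).L : ℝ) ^ ((F.P K).d - 1))⁻¹)
    (hbudget : αD + ((((F.P K).d + 2) * (F.P K).L : ℕ) : ℝ) * (Real.exp (3 * ((1 : ℝ) / (10 ^ 8 * (F.P K).d * (F.P K).L))) - 1) ≤ α)
    (hrR : r ≤ (1 : ℝ) / (10 ^ 8 * (F.P K).d * (F.P K).L))
    (hρD : ρD = (min ((1 : ℝ) / (10 ^ 8 * (F.P K).d * (F.P K).L) / 3) (1 / (18 * (2 * 1 / (1 / (10 ^ 8 * (F.P K).d * (F.P K).L)) ^ 2) * ((6 / ((((F.P K).L : ℝ) ^ ((F.P K).d - 1))⁻¹ - 157 * αD)) + 1)))))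
    {T : PBond (F.P K) (k + 1) → GaugeField (F.P K) k (SU 2) → Set (SU 2)}
    {ϑ : PBond (F.P K) (k + 1) → GaugeField (F.P K) k (SU 2) → SU 2 → SU 2}
    {jd jac' : PBond (F.P K) (k + 1) → GaugeField (F.P K) k (SU 2) → SU 2 → ℝ≥0}
    (hTm : ∀ c, MeasurableSet {p : GaugeField (F.P K) k (SU 2) × SU 2 | p.2 ∈ T c p.1})
    (hθm : ∀ c, Measurable fun p : GaugeField (F.P K) k (SU 2) × SU 2 => ϑ c p.1 p.2)
    (hjm : ∀ c, Measurable fun p : GaugeField (F.P K) k (SU 2) × SU 2 => jd c p.1 p.2)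
    (hjacm : ∀ c, Measurable fun p : GaugeField (F.P K) k (SU 2) × SU 2 => jac' c p.1 p.2)
    (hright : ∀ c U, ∀ v ∈ T c U, (avOfRecord F 2 K k).avg (update U (centralBond c) (ϑ c U v)) c = v)
    (hTim : ∀ c U, T c U = (fun g => (avOfRecord F 2 K k).avg (update U (centralBond c) g) c) ''
      {g : SU 2 | ∀ i : Idx (F.P K), dist1 (fibreFamily U c (pre U c * g * post U c) i) ≤ α})
    (hleft : ∀ c U g, (∀ i : Idx (F.P K), dist1 (fibreFamily U c (pre U c * g * post U c) i) ≤ α) →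
      ϑ c U ((avOfRecord F 2 K k).avg (update U (centralBond c) g) c) = g)
    (hQ : ∀ c U v, jd c U v = (jac' c U (ϑ c U v))⁻¹)
    (hjac0 : ∀ c U g, (∀ i : Idx (F.P K), dist1 (fibreFamily U c (pre U c * g * post U c) i) ≤ α) → jac' c U g ≠ 0)
    (hfwd : ∀ c U, (HaarData.haar : Measure (SU 2)).restrict
        ((fun g => (avOfRecord F 2 K k).avg (update U (centralBond c) g) c) ''
          {g : SU 2 | ∀ i : Idx (F.P K), dist1 (fibreFamily U c (pre U c * g * post U c) i) ≤ α}) =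
      (((HaarData.haar : Measure (SU 2)).restrict {g : SU 2 | ∀ i : Idx (F.P K), dist1 (fibreFamily U c (pre U c * g * post U c) i) ≤ α}).withDensity
          fun g => (jac' c U g : ℝ≥0∞)).map (fun g => (avOfRecord F 2 K k).avg (update U (centralBond c) g) c))
    (hjacc : ∀ c U, ContinuousOn (jac' c U) {g : SU 2 | ∀ i : Idx (F.P K), dist1 (fibreFamily U c (pre U c * g * post U c) i) ≤ α})
    (hTbl : ∀ c U (g : PBond (F.P K) (k + 1) → SU 2), T c (extend centralBond g U) = T c U)
    (hθbl : ∀ c U (g : PBond (F.P K) (k + 1) → SU 2), ϑ c (extend centralBond g U) = ϑ c U)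
    (hjbl : ∀ c U (g : PBond (F.P K) (k + 1) → SU 2), jd c (extend centralBond g U) = jd c U)
    (ctr : (PBond (F.P K) (k + 1) → SU 2) → GaugeField (F.P K) k (SU 2)) {U₀ : Set (PBond (F.P K) (k + 1) → SU 2)}
    (hUG : ∀ W ∈ U₀, (avOfRecord F 2 K k).avg (ctr W) = W ∧ ∀ (c : PBond (F.P K) (k + 1)) (i : Idx (F.P K)), dist1 (loopHol (ctr W) c i) ≤ αD)
    (hCr : ∀ W ∈ U₀, ∀ y : NonB0Idx F k K → ℝ, (∀ (b : PBond (F.P K) k) (hb : b ∉ Set.range (recordB0 F k K)), √(∑ a : Fin 3, y ⟨(b, a), hb⟩ ^ 2) < r) →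
      ‖(fun i => ((((1 : ℝ) • (recordCopFluct F k K (ctr W) *ᵥ y)) i : ℝ) : ℂ))‖ < ρD)
    {ρ : Density (F.P K) k (SU 2)} (hρm : Measurable ρ)
    (hS : ∀ U, ρ U ≠ 0 → (∀ (c : PBond (F.P K) (k + 1)) (i : Idx (F.P K)), dist1 (loopHol U c i) < α) ∧
      ∃ x : FluctIdx F k K → ℝ, (∀ b, ‖fluctVec F k K x b‖ < r) ∧ U = pert F k K (ctr ((avOfRecord F 2 K k).avg U)) x) :
    ContinuousOn (fun W : PBond (F.P K) (k + 1) → SU 2 =>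
      (sigmaSU2 0) ^ Fintype.card {b : PBond (F.P K) k // b ∉ Set.range (recordB0 F k K)} *
          ∫ y in {y : NonB0Idx F k K → ℝ | ∀ (b : PBond (F.P K) k) (hb : b ∉ Set.range (recordB0 F k K)), √(∑ a : Fin 3, y ⟨(b, a), hb⟩ ^ 2) < r},
            fluctSigma (fluctVec F k K (recordReparamOf F k (fun Vk => recordDt F k K Vk ρD) (ctr W) 1 (recordCopFluct F k K (ctr W) *ᵥ y))) *
          ((∏ c : PBond (F.P K) (k + 1),
              |(fderiv ℝ (fun a : EuclideanSpace ℝ (Fin 3) =>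
                  (WithLp.toLp 2 (su2Coord (recordQt F k K (ctr W) ((fluctVec F k K).symm (update (fluctVec F k K
                    (recordReparamOf F k (fun Vk => recordDt F k K Vk ρD) (ctr W) 1 (recordCopFluct F k K (ctr W) *ᵥ y))) (centralBond c) a)) c)) : EuclideanSpace ℝ (Fin 3)))
                (fluctVec F k K (recordReparamOf F k (fun Vk => recordDt F k K Vk ρD) (ctr W) 1 (recordCopFluct F k K (ctr W) *ᵥ y)) (centralBond c))).det|)⁻¹ *
            ρ (pert F k K (ctr W) (recordReparamOf F k (fun Vk => recordDt F k K Vk ρD) (ctr W) 1 (recordCopFluct F k K (ctr W) *ᵥ y))))) U₀ ↔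
    ContinuousOn (fun W : PBond (F.P K) (k + 1) → SU 2 => ∫ U, ((({p : GaugeField (F.P K) (k + 1) (SU 2) × GaugeField (F.P K) k (SU 2) | ∀ c, p.1 c ∈ T c p.2}.indicator (fun p => ∏ c, jd c p.2 (p.1 c)) (W, U) : ℝ≥0) : ℝ) *
        ρ (extend centralBond (fun c => ϑ c U (W c)) U)) ∂(fieldMeasure (F.P K) k (SU 2))) U₀ := by
  refine (continuousOn_congr fun W hWU => ?_).symm.symm
  exact (integral_privateChart_eq_integral_solvedChart hk hαDL hbudget hrR hρD hTm hθm hjm hjacm hright hTim hleft hQ hjac0 hfwd hjacc hTbl hθbl hjbl ctr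
    (hUG W hWU).1 (hUG W hWU).2 (hCr W hWU) hρm hS).symm

end Pointwise


/-! ## §3  (★) pointwise from the continuity of the fibre integral of ANY blind sharp bundle -/

section Star

variable {F}

/-- ★★★ **(★) POINTWISE FROM `hgc` IN dag-n09's CURRENCY**: under the hypotheses of ✓`transportOfRecord_ae_eq_integral_solvedChart`, on an open `U₀` whose points satisfy `Ū(ctr W) = W` and
loops `≤ αD`, IF the fibre integral `W ↦ ∫ 𝟙·Π_c jd_c·ρ∘Ψ dU` of SOME blind sharp bundle (N11's clauses) is continuous on `U₀` — the `hgc` that dag-n09's (F1) tower proves for the record's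
β-input density — THEN `TcanOfRecord F 2 K k ρ W =` the solved-form integral at EVERY `W ∈ U₀`. [cite: Balaban1987RG1, (2.10) p.267, (0.19) p.255, p.259] [cite: Balaban1985UV3, (18) p.260] -/
theorem TcanOfRecord_eq_integral_solvedChart_of_fibreIntegral_continuousOn {K k : ℕ} (hk : k < K) {α αD r : ℝ} (hα0 : 0 ≤ α) (hα : α ≤ 1 / 24) (hα64 : 64 * α ≤ deltaSU (Fin 2))
    (hαL : 157 * α < (((F.P K).L : ℝ) ^ ((F.P K).d - 1))⁻¹)
    (hgap : ∀ c : PBond (F.P K) (k + 1), (offCard c : ℝ) / (Fintype.card (Idx (F.P K)) : ℝ) + 150 * α < 1)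
    (hbudget : αD + ((((F.P K).d + 2) * (F.P K).L : ℕ) : ℝ) * (Real.exp (3 * ((1 : ℝ) / (10 ^ 8 * (F.P K).d * (F.P K).L))) - 1) ≤ α)
    (hrR : r ≤ (1 : ℝ) / (10 ^ 8 * (F.P K).d * (F.P K).L)) {ρD : ℝ}
    (hρD : ρD = (min ((1 : ℝ) / (10 ^ 8 * (F.P K).d * (F.P K).L) / 3) (1 / (18 * (2 * 1 / (1 / (10 ^ 8 * (F.P K).d * (F.P K).L)) ^ 2) * ((6 / ((((F.P K).L : ℝ) ^ ((F.P K).d - 1))⁻¹ - 157 * αD)) + 1)))))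
    (ctr : (PBond (F.P K) (k + 1) → SU 2) → GaugeField (F.P K) k (SU 2))
    (hCr : ∀ W : PBond (F.P K) (k + 1) → SU 2, (avOfRecord F 2 K k).avg (ctr W) = W → (∀ (c : PBond (F.P K) (k + 1)) (i : Idx (F.P K)), dist1 (loopHol (ctr W) c i) ≤ αD) →
      ∀ y : NonB0Idx F k K → ℝ, (∀ (b : PBond (F.P K) k) (hb : b ∉ Set.range (recordB0 F k K)), √(∑ a : Fin 3, y ⟨(b, a), hb⟩ ^ 2) < r) →
        ‖(fun i => ((((1 : ℝ) • (recordCopFluct F k K (ctr W) *ᵥ y)) i : ℝ) : ℂ))‖ < ρD)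
    {ρ : Density (F.P K) k (SU 2)} (hρm : Measurable ρ) (hρ : Integrable ρ (fieldMeasure (F.P K) k (SU 2)))
    (hS : ∀ U, ρ U ≠ 0 → (∀ (c : PBond (F.P K) (k + 1)) (i : Idx (F.P K)), dist1 (loopHol U c i) < α) ∧
      ∃ x : FluctIdx F k K → ℝ, (∀ b, ‖fluctVec F k K x b‖ < r) ∧ U = pert F k K (ctr ((avOfRecord F 2 K k).avg U)) x)
    {T : PBond (F.P K) (k + 1) → GaugeField (F.P K) k (SU 2) → Set (SU 2)}
    {ϑ : PBond (F.P K) (k + 1) → GaugeField (F.P K) k (SU 2) → SU 2 → SU 2}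
    {jd jac' : PBond (F.P K) (k + 1) → GaugeField (F.P K) k (SU 2) → SU 2 → ℝ≥0}
    (hTm : ∀ c, MeasurableSet {p : GaugeField (F.P K) k (SU 2) × SU 2 | p.2 ∈ T c p.1})
    (hθm : ∀ c, Measurable fun p : GaugeField (F.P K) k (SU 2) × SU 2 => ϑ c p.1 p.2)
    (hjm : ∀ c, Measurable fun p : GaugeField (F.P K) k (SU 2) × SU 2 => jd c p.1 p.2)
    (hjacm : ∀ c, Measurable fun p : GaugeField (F.P K) k (SU 2) × SU 2 => jac' c p.1 p.2)
    (hright : ∀ c U, ∀ v ∈ T c U, (avOfRecord F 2 K k).avg (update U (centralBond c) (ϑ c U v)) c = v)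
    (hTim : ∀ c U, T c U = (fun g => (avOfRecord F 2 K k).avg (update U (centralBond c) g) c) ''
      {g : SU 2 | ∀ i : Idx (F.P K), dist1 (fibreFamily U c (pre U c * g * post U c) i) ≤ α})
    (hleft : ∀ c U g, (∀ i : Idx (F.P K), dist1 (fibreFamily U c (pre U c * g * post U c) i) ≤ α) →
      ϑ c U ((avOfRecord F 2 K k).avg (update U (centralBond c) g) c) = g)
    (hQ : ∀ c U v, jd c U v = (jac' c U (ϑ c U v))⁻¹)
    (hjac0 : ∀ c U g, (∀ i : Idx (F.P K), dist1 (fibreFamily U c (pre U c * g * post U c) i) ≤ α) → jac' c U g ≠ 0)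
    (hfwd : ∀ c U, (HaarData.haar : Measure (SU 2)).restrict
        ((fun g => (avOfRecord F 2 K k).avg (update U (centralBond c) g) c) ''
          {g : SU 2 | ∀ i : Idx (F.P K), dist1 (fibreFamily U c (pre U c * g * post U c) i) ≤ α}) =
      (((HaarData.haar : Measure (SU 2)).restrict {g : SU 2 | ∀ i : Idx (F.P K), dist1 (fibreFamily U c (pre U c * g * post U c) i) ≤ α}).withDensity
          fun g => (jac' c U g : ℝ≥0∞)).map (fun g => (avOfRecord F 2 K k).avg (update U (centralBond c) g) c))
    (hjacc : ∀ c U, ContinuousOn (jac' c U) {g : SU 2 | ∀ i : Idx (F.P K), dist1 (fibreFamily U c (pre U c * g * post U c) i) ≤ α})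
    (hTbl : ∀ c U (g : PBond (F.P K) (k + 1) → SU 2), T c (extend centralBond g U) = T c U)
    (hθbl : ∀ c U (g : PBond (F.P K) (k + 1) → SU 2), ϑ c (extend centralBond g U) = ϑ c U)
    (hjbl : ∀ c U (g : PBond (F.P K) (k + 1) → SU 2), jd c (extend centralBond g U) = jd c U)
    {U₀ : Set (PBond (F.P K) (k + 1) → SU 2)} (hU : IsOpen U₀)
    (hUG : ∀ W ∈ U₀, (avOfRecord F 2 K k).avg (ctr W) = W ∧ ∀ (c : PBond (F.P K) (k + 1)) (i : Idx (F.P K)), dist1 (loopHol (ctr W) c i) ≤ αD)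
    (hcont : ContinuousOn (fun W : PBond (F.P K) (k + 1) → SU 2 => ∫ U, ((({p : GaugeField (F.P K) (k + 1) (SU 2) × GaugeField (F.P K) k (SU 2) | ∀ c, p.1 c ∈ T c p.2}.indicator (fun p => ∏ c, jd c p.2 (p.1 c)) (W, U) : ℝ≥0) : ℝ) *
        ρ (extend centralBond (fun c => ϑ c U (W c)) U)) ∂(fieldMeasure (F.P K) k (SU 2))) U₀) :
    EqOn (TcanOfRecord F 2 K k ρ) (fun W : PBond (F.P K) (k + 1) → SU 2 =>
      (sigmaSU2 0) ^ Fintype.card {b : PBond (F.P K) k // b ∉ Set.range (recordB0 F k K)} *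
          ∫ y in {y : NonB0Idx F k K → ℝ | ∀ (b : PBond (F.P K) k) (hb : b ∉ Set.range (recordB0 F k K)), √(∑ a : Fin 3, y ⟨(b, a), hb⟩ ^ 2) < r},
            fluctSigma (fluctVec F k K (recordReparamOf F k (fun Vk => recordDt F k K Vk ρD) (ctr W) 1 (recordCopFluct F k K (ctr W) *ᵥ y))) *
          ((∏ c : PBond (F.P K) (k + 1),
              |(fderiv ℝ (fun a : EuclideanSpace ℝ (Fin 3) =>
                  (WithLp.toLp 2 (su2Coord (recordQt F k K (ctr W) ((fluctVec F k K).symm (update (fluctVec F k K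
                    (recordReparamOf F k (fun Vk => recordDt F k K Vk ρD) (ctr W) 1 (recordCopFluct F k K (ctr W) *ᵥ y))) (centralBond c) a)) c)) : EuclideanSpace ℝ (Fin 3)))
                (fluctVec F k K (recordReparamOf F k (fun Vk => recordDt F k K Vk ρD) (ctr W) 1 (recordCopFluct F k K (ctr W) *ᵥ y)) (centralBond c))).det|)⁻¹ *
            ρ (pert F k K (ctr W) (recordReparamOf F k (fun Vk => recordDt F k K Vk ρD) (ctr W) 1 (recordCopFluct F k K (ctr W) *ᵥ y))))) U₀ := by
  have hx0 : (0 : ℝ) ≤ 3 * ((1 : ℝ) / (10 ^ 8 * (F.P K).d * (F.P K).L)) := by positivity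
  have hbud0 : (0 : ℝ) ≤ ((((F.P K).d + 2) * (F.P K).L : ℕ) : ℝ) * (Real.exp (3 * ((1 : ℝ) / (10 ^ 8 * (F.P K).d * (F.P K).L))) - 1) :=
    mul_nonneg (Nat.cast_nonneg _) (by linarith [Real.add_one_le_exp (3 * ((1 : ℝ) / (10 ^ 8 * (F.P K).d * (F.P K).L)))])
  have hαDL : 157 * αD < (((F.P K).L : ℝ) ^ ((F.P K).d - 1))⁻¹ := by linarith
  have hgc := (continuousOn_solvedChart_iff_fibreIntegral hk hαDL hbudget hrR hρD hTm hθm hjm hjacm hright hTim hleft hQ hjac0 hfwd hjacc hTbl hθbl hjbl ctr hUG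
    (fun W hWU => hCr W (hUG W hWU).1 (hUG W hWU).2) hρm hS).2 hcont
  exact TcanOfRecord_eq_integral_solvedChart_of_continuousOn hk hα0 hα hα64 hαL hgap hbudget hrR hρD ctr hCr hρm hρ hS hU hUG hgc

end Star

end Summit.QuantumFields.YangMills.Theorems.BalabanUVNodesPortS1

end
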